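import Mathlib.GroupTheory.OrderOfElement
import Mathlib.GroupTheory.Coset.Basic
import Mathlib.GroupTheory.GroupAction.Quotient
import Mathlib.Algebra.BigOperators.GroupWithZero.Action
import Mathlib.Algebra.Group.Subgroup.Basic
import Mathlib.Algebra.Module.Defs
import Mathlib.Tactic
import HarnessLib

/-!
# Cell «bsd-uniform», track U2 — `GenusCongruence`: the ALGEBRA of the «a_q-odd combination at 2»
# (T4-PROOF L2′ + Theorem A first half): parity transport of `2`-indivisibility from `y_K` to the
# genus point `P(χ_M)` (sorry-free; route C seat u2-p3, PLAN.md §2 U2 deliverable (ii))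

HONEST FRAMING (cell «bsd-uniform», run/shared/lean/pub/bsd-uniform/, seat u2-p3): this file is
PURE ALGEBRA — an additive commutative group `A` (to be `E(H_M)`, the points over a ring class
field), a family of additive endomorphisms `ρ : G → AddMonoid.End A` indexed by a type/group `G`
(to be the action of `Gal(H_M/K)`), and finite sums. It asserts NO arithmetic fact, names NO elliptic curve, and is NOT
a claim about the Birch–Swinnerton-Dyer conjecture or any summit. What it proves is exactly the
step that the «bsd-p2» literature verdict found NOT IN PRINT (pub/bsd-director/P2-SUBLANE.md l.42
(5); p2/LIT-STATUS.md T2-I2/I3 (iii)): "the a_q-ODD, `E(ℚ)[2] = 0` use of the trace identity —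
`2`-indivisibility of `y_K` transports to the genus point". The printed ingredients it is designed to
CONSUME enter the class-level file `Uniform/U2/GenusTwistClassesAtTwo.lean` as named hypotheses in
exactly the shapes produced here (PLAN.md §1 row u2-p3: "FIRST owner of the not-in-print step
`GenusCongruence.lean` (L1 + L2′)"; L1 — no `2`-torsion up the ring-class tower — is NOT proved in this
file: its conclusion is the hypothesis `h2`, see RESIDUE.md §U2 row R-L1):
* the one-step norm relations `Tr_{H_{qm}/H_m} P_{qm} = a_q · P_m` (`q` inert; Gross 1991
  Prop. 3.7 (1); Coates–Li–Tian–Zhai 2015 Lemma 2.9; Bradshaw–Stein 2012 §3 for the composed form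
  `Tr_{K_c/K} y_c = a_c y_K`) and `Tr_{H_{qm}/H_m} P_{qm} = (a_q − σ_𝔮 − σ_𝔮⁻¹) · P_m` (`q` split;
  Darmon, CBMS 101, Prop. 3.10) — consumed by `sum_eq_smul_sum_quotient_of_trace_eq_smul` /
  `sum_eq_sub_two_smul_sum_quotient_of_trace_eq` (§3), whose output is the shape
  `∑_{g ∈ G} g·P_M = m · y_K`, `m` odd, of hypothesis `htr` below;
* "`E(H_M)[2] = 0`" (no `2`-torsion up the ring-class tower; T4-PROOF L1) — hypothesis `h2`;
* "(H-y) `y_K ∉ 2E(K)`" — hypothesis `hndiv` (in fixed-point form; Galois descent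
  `exists_map_eq_of_forall_map_galois_eq` of the tree converts the `E(K)`-form).

## Contents (all proved)

* §1 Groups without `2`-torsion (hypothesis `h2 : ∀ a, 2 • a = 0 → a = 0`): a torsion element of a group without `2`-torsion has
  ODD order (`odd_addOrderOf`) and is twice a torsion element (`exists_two_nsmul_eq_of_isOfFinAddOrder`);
  halving commutes with fixed points (`forall_fixed_of_two_nsmul_eq`).
* §2 THE TRANSPORT THEOREM `not_isOfFinAddOrder_of_sub_smul_eq_two_nsmul`: if `y` is `G`-fixed and
  NOT twice a `G`-fixed element, and `P ≡ u·y (mod 2A)` with `u` odd, then `P` has infinite order;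
  and its genus-point form `not_isOfFinAddOrder_genusPoint`: for `χ : G → ℤˣ` and
  `∑_g ρ g P_M = m · y` with `m` odd, the point `P(χ) = ∑_g χ(g) · ρ g P_M` has infinite order
  (the `χ`-sum is congruent to the plain trace mod `2A`: `exists_sum_units_smul_sub_sum_eq_two_nsmul`).
* §3 Trace bookkeeping for a commutative `G` (`= Gal(H_M/K)`, ONE ambient group, nested subgroups
  `Gal(H_M/H_m)` as in the tree's `KolyvaginHeegnerData`): coset decomposition
  `∑_{g∈G} ρ g P = ∑_{c ∈ G/H} ρ c̃ (∑_{h∈H} ρ h P)`; the inert relation `∑_H ρ h P = a · P₁` gives total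
  trace `a · T`, the split relation `∑_H ρ h P = a · P₁ − (ρ σ P₁ + ρ σ⁻¹ P₁)` gives `(a − 2) · T`,
  `T = ∑_{c ∈ G/H} ρ c̃ P₁`; RELATIVE traces `∑_{e ∈ H′/H} ρ ẽ x` for `H ≤ H′`: representative
  independence, transitivity `Σ_{G/H} = Σ_{G/H′} ∘ Σ_{H′/H}`, the relative inert / split folds, the
  two-level template `sum_eq_mul_smul_of_two_steps`, odd products — so a tower of `a_q`-odd steps
  yields `∑_{g} ρ g P_M = m · y_K` with `m = ∏ a_q · ∏ (a_q − 2)` odd, the `htr` of the class file.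

References: Gross, LMS LNS 153 (1991) Prop. 3.7 [GrossLMS1991]; Darmon, CBMS 101 (2004) Prop. 3.10
[Darmon2004]; Coates–Li–Tian–Zhai, PLMS 110 (2015) Lemma 2.9 [CoatesLiTianZhai2015];
b2b/bsd-rank1-residual/p2/idea-2/T4-PROOF.md v1.9b §3 L2′, §4 Theorem A.
-/

noncomputable section

open scoped Classical

set_option autoImplicit false

namespace Summit.BirchSwinnertonDyer.Uniform.U2.GenusCongruence

open Finset

variable {A : Type*} [AddCommGroup A]

/-! ## §1 Groups without `2`-torsion -/

/-- In a group without `2`-torsion, doubling is injective. [folklore] -/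
theorem two_nsmul_injective (h2 : ∀ a : A, (2 : ℕ) • a = 0 → a = 0) :
    Function.Injective fun a : A => (2 : ℕ) • a := fun a b hab =>
  sub_eq_zero.mp (h2 _ (by rw [nsmul_sub]; exact sub_eq_zero.mpr hab))

/-- In a group without `2`-torsion every element of finite order has ODD order. [folklore] -/
theorem odd_addOrderOf (h2 : ∀ a : A, (2 : ℕ) • a = 0 → a = 0) {t : A} (ht : IsOfFinAddOrder t) :
    Odd (addOrderOf t) := by
  by_contra hodd
  rw [Nat.not_odd_iff_even] at hodd
  obtain ⟨k, hk⟩ := hodd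
  have hpos : 0 < addOrderOf t := ht.addOrderOf_pos
  have hkt : (2 : ℕ) • (k • t) = 0 := by
    rw [← mul_nsmul', two_mul, ← hk]
    exact addOrderOf_nsmul_eq_zero t
  have hk0 : k • t = 0 := h2 _ hkt
  have hdvd : addOrderOf t ∣ k := addOrderOf_dvd_of_nsmul_eq_zero hk0
  have hkpos : 0 < k := by omega
  have := Nat.le_of_dvd hkpos hdvd
  omega

/-- In a group without `2`-torsion every element of finite order is twice an element of finite
order (`2` is invertible modulo the odd order). [folklore] -/
theorem exists_two_nsmul_eq_of_isOfFinAddOrder (h2 : ∀ a : A, (2 : ℕ) • a = 0 → a = 0) {t : A}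
    (ht : IsOfFinAddOrder t) : ∃ s : A, IsOfFinAddOrder s ∧ (2 : ℕ) • s = t := by
  obtain ⟨k, hk⟩ := odd_addOrderOf h2 ht
  refine ⟨(k + 1) • t, ht.nsmul, ?_⟩
  rw [← mul_nsmul', show 2 * (k + 1) = addOrderOf t + 1 by omega, add_nsmul, one_nsmul,
    addOrderOf_nsmul_eq_zero, zero_add]

section Action

-- Only additivity of each `ρ g` is used in §1–§2: `ρ` is ANY family of additive endomorphisms
-- (a `G →* AddMonoid.End A` coerces to such a family).
variable {G : Type*} (ρ : G → AddMonoid.End A)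

/-- Halving commutes with taking fixed points: if `y = 2R` is fixed by every `ρ g` and `A` has no
`2`-torsion, then `R` is fixed by every `ρ g` (T4-PROOF §4, proof of Theorem A: "`2(R^σ − R) = 0`,
so `R^σ = R`"). [folklore] -/
theorem forall_fixed_of_two_nsmul_eq (h2 : ∀ a : A, (2 : ℕ) • a = 0 → a = 0) {y R : A} (hy : ∀ g : G, ρ g y = y)
    (hR : (2 : ℕ) • R = y) : ∀ g : G, ρ g R = R := by
  intro g
  apply two_nsmul_injective h2
  change (2 : ℕ) • ρ g R = (2 : ℕ) • R
  rw [← map_nsmul, hR, hy g]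

/-! ## §2 The transport theorem -/

/-- **PARITY TRANSPORT OF `2`-INDIVISIBILITY (the algebraic core of the «a_q-odd combination at 2»,
T4-PROOF §4 Theorem A, first half).** Let `G` act on `A` (no `2`-torsion) by additive maps, let `y`
be `G`-fixed and NOT twice a `G`-fixed element, and let `P ≡ u · y (mod 2A)` with `u` odd. Then `P`
has infinite order. Proof: a torsion `P` is `2s` (odd order), so `u·y ∈ 2A`, so `y ∈ 2A` (`u` odd),
say `y = 2R`; then `R` is `G`-fixed — contradiction. [folklore] -/
theorem not_isOfFinAddOrder_of_sub_smul_eq_two_nsmul (h2 : ∀ a : A, (2 : ℕ) • a = 0 → a = 0)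
    {y P : A} (hy : ∀ g : G, ρ g y = y)
    (hndiv : ¬ ∃ R : A, (∀ g : G, ρ g R = R) ∧ (2 : ℕ) • R = y)
    {u : ℤ} (hu : Odd u) (hP : ∃ Q : A, P - u • y = (2 : ℕ) • Q) : ¬ IsOfFinAddOrder P := by
  intro hfin
  obtain ⟨s, -, hs⟩ := exists_two_nsmul_eq_of_isOfFinAddOrder h2 hfin
  obtain ⟨Q, hQ⟩ := hP
  obtain ⟨k, hk⟩ := hu
  have hR : (2 : ℕ) • (s - Q - k • y) = y := by
    rw [nsmul_sub, nsmul_sub, hs, ← hQ]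
    have e2 : ((2 : ℕ) • (k • y) : A) = (2 * k) • y := by
      rw [mul_zsmul, two_zsmul, two_nsmul]
    rw [e2, hk, add_zsmul, one_zsmul]
    abel
  exact hndiv ⟨s - Q - k • y, forall_fixed_of_two_nsmul_eq ρ h2 hy hR, hR⟩

/-- The `χ`-twisted sum is congruent to the plain sum modulo `2A` for a `±1`-valued `χ` (T4-PROOF
§3 L2′: "`χ_M` takes values `±1`, so `P(χ_M) − Σ_σ P_M^σ = −2 Σ_{χ_M(σ) = −1} P_M^σ ∈ 2E(H_M)`").
[folklore] -/
theorem exists_sum_units_smul_sub_sum_eq_two_nsmul {ι : Type*} (s : Finset ι) (χ : ι → ℤˣ)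
    (x : ι → A) : ∃ Q : A, ∑ i ∈ s, ((χ i : ℤ) • x i) - ∑ i ∈ s, x i = (2 : ℕ) • Q := by
  classical
  refine ⟨∑ i ∈ s, (if χ i = 1 then (0 : A) else -x i), ?_⟩
  rw [← Finset.sum_sub_distrib, Finset.smul_sum]
  refine Finset.sum_congr rfl fun i _ => ?_
  rcases Int.units_eq_one_or (χ i) with h | h
  · simp [h]
  · rw [if_neg (by rw [h]; decide), h]
    simp only [Units.val_neg, Units.val_one, neg_smul, one_smul, smul_neg, two_nsmul]
    abel

/-- **THE GENUS POINT HAS INFINITE ORDER (T4-PROOF Theorem A, first half, algebraic form).** `G`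
finite acting on `A` without `2`-torsion; `y` (`= y_K`) `G`-fixed and not twice a `G`-fixed element
(hypothesis (H-y)); `P_M ∈ A` with total trace `∑_g ρ g P_M = m · y`, `m` ODD (the composed norm
relation: `m = ∏_{q inert} a_q · ∏_{q split} (a_q − 2)`); `χ : G → ℤˣ` any sign character (the genus
character `χ_M`). Then `P(χ) = ∑_g χ(g) · ρ g P_M` has infinite order. [folklore] -/
theorem not_isOfFinAddOrder_genusPoint [Fintype G] (h2 : ∀ a : A, (2 : ℕ) • a = 0 → a = 0)
    {y PM : A} (hy : ∀ g : G, ρ g y = y)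
    (hndiv : ¬ ∃ R : A, (∀ g : G, ρ g R = R) ∧ (2 : ℕ) • R = y)
    (χ : G → ℤˣ) {m : ℤ} (hm : Odd m) (htr : ∑ g, ρ g PM = m • y) :
    ¬ IsOfFinAddOrder (∑ g, (χ g : ℤ) • ρ g PM) := by
  obtain ⟨Q, hQ⟩ := exists_sum_units_smul_sub_sum_eq_two_nsmul Finset.univ χ fun g => ρ g PM
  refine not_isOfFinAddOrder_of_sub_smul_eq_two_nsmul ρ h2 hy hndiv hm ⟨Q, ?_⟩
  rw [← htr]
  exact hQ

end Action

/-! ## §3 One-step trace bookkeeping along `K ⊂ H_m ⊂ H_{qm}` -/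

section Tower

variable {G : Type*} [Group G] (ρ : G →* AddMonoid.End A) (H : Subgroup G)

/-- `ρ (a * b) x = ρ a (ρ b x)`. [folklore] -/
theorem map_mul_apply (a b : G) (x : A) : ρ (a * b) x = ρ a (ρ b x) := by
  rw [map_mul]
  rfl

/-- Coset decomposition of the total trace: `∑_{g ∈ G} ρ g P = ∑_{c ∈ G/H} ρ c̃ (∑_{h ∈ H} ρ h P)`
for the section `c ↦ c̃ = c.out` of `G → G/H`. [folklore] -/
theorem sum_eq_sum_quotient_sum_subgroup [Fintype G] [Fintype H] [Fintype (G ⧸ H)] (P : A) :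
    ∑ g : G, ρ g P = ∑ c : G ⧸ H, ρ c.out (∑ h : H, ρ (h : G) P) := by
  have hrhs : ∑ c : G ⧸ H, ρ c.out (∑ h : H, ρ (h : G) P) =
      ∑ ch : (G ⧸ H) × H, ρ (ch.1.out * (ch.2 : G)) P := by
    rw [Fintype.sum_prod_type]
    refine Finset.sum_congr rfl fun c _ => ?_
    rw [map_sum]
    refine Finset.sum_congr rfl fun h _ => ?_
    rw [map_mul_apply]
  rw [hrhs]
  symm
  refine Fintype.sum_bijective (fun ch : (G ⧸ H) × H => ch.1.out * (ch.2 : G)) ⟨?_, ?_⟩ _ _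
    (fun _ => rfl)
  · rintro ⟨c, h⟩ ⟨c', h'⟩ hEq
    simp only at hEq
    have hcc : c = c' := by
      have e := congrArg (QuotientGroup.mk (s := H)) hEq
      rwa [QuotientGroup.mk_mul_of_mem _ h.2, QuotientGroup.mk_mul_of_mem _ h'.2,
        QuotientGroup.out_eq', QuotientGroup.out_eq'] at e
    subst hcc
    have hh : (h : G) = h' := mul_left_cancel hEq
    rw [Subtype.ext hh]
  · intro g
    obtain ⟨h, hh⟩ := QuotientGroup.mk_out_eq_mul H g
    refine ⟨((g : G ⧸ H), h⁻¹), ?_⟩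
    simp only
    rw [hh, Subgroup.coe_inv, mul_inv_cancel_right]

/-- The trace over coset representatives of an `H`-fixed point is `G`-fixed:
`ρ σ (∑_{c} ρ c̃ P₁) = ∑_{c} ρ c̃ P₁` whenever `P₁` is fixed by `H` (reindex by `c ↦ σ • c`; the
representatives `σ c̃` and `(σc)̃ ` differ by an element of `H`). [folklore] -/
theorem smul_sum_quotient_eq [Fintype (G ⧸ H)] (P₁ : A) (hP₁ : ∀ h : H, ρ (h : G) P₁ = P₁)
    (σ : G) :
    ρ σ (∑ c : G ⧸ H, ρ c.out P₁) = ∑ c : G ⧸ H, ρ c.out P₁ := by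
  rw [map_sum]
  have key : ∀ c : G ⧸ H, ρ σ (ρ c.out P₁) = ρ (σ • c).out P₁ := by
    intro c
    have hc : (σ • c : G ⧸ H) = ((σ * c.out : G) : G ⧸ H) := by
      rw [← smul_eq_mul, ← MulAction.Quotient.smul_coe, QuotientGroup.out_eq']
    obtain ⟨h, hh⟩ := QuotientGroup.mk_out_eq_mul H (σ * c.out)
    rw [hc, hh, map_mul_apply, map_mul_apply, hP₁ h]
  simp_rw [key]
  exact Fintype.sum_equiv (MulAction.toPerm σ) _ _ (fun c => rfl)

/-- **Inert step** (Gross 1991 Prop. 3.7 (1) / CLTZ 2015 Lemma 2.9: `Tr_{H_{qm}/H_m} P_{qm} = a_q P_m`):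
if `∑_{h ∈ H} ρ h P = a · P₁` then `∑_{g ∈ G} ρ g P = a · ∑_{c ∈ G/H} ρ c̃ P₁`. (For the
arithmetic consumer with `a_q` ODD the printed source is CLTZ 2015's "general fact first observed
by Kolyvagin" [arXiv:1312.3884 p0008 L44–L48], not Gross's Prop. 3.7, which sits under
(3.1)–(3.3): referee ADVISORY A2.) [cite: CoatesLiTianZhai2015, Lemma 2.9]
[cite: GrossLMS1991, Prop. 3.7 (1)] -/
theorem sum_eq_smul_sum_quotient_of_trace_eq_smul [Fintype G] [Fintype H] [Fintype (G ⧸ H)]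
    {P P₁ : A} {a : ℤ}
    (hrel : ∑ h : H, ρ (h : G) P = a • P₁) :
    ∑ g : G, ρ g P = a • ∑ c : G ⧸ H, ρ c.out P₁ := by
  rw [sum_eq_sum_quotient_sum_subgroup ρ H, hrel, Finset.smul_sum]
  refine Finset.sum_congr rfl fun c _ => ?_
  rw [map_zsmul]

/-! ### Relative traces along nested subgroups `H ≤ H' ≤ G` (the tower `K ⊂ H_m ⊂ H_{m'} ⊂ H_M`
read inside ONE ambient Galois group `G = Gal(H_M/K)`, as in the tree's `KolyvaginHeegnerData`) -/

/-- Representative-independence: for an `H`-fixed `x`, `ρ ((gH)̃ ) x = ρ g x`. [folklore] -/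
theorem map_out_mk_apply {x : A} (hx : ∀ h : H, ρ (h : G) x = x) (g : G) :
    ρ ((g : G ⧸ H).out) x = ρ g x := by
  obtain ⟨h, hh⟩ := QuotientGroup.mk_out_eq_mul H g
  rw [hh, map_mul_apply, hx h]

/-- The same inside a larger subgroup `H'` (`H ≤ H'`, quotient `H' ⧸ H.subgroupOf H'`). [folklore] -/
theorem map_out_mk_subgroupOf_apply (H' : Subgroup G) {x : A} (hx : ∀ h : H, ρ (h : G) x = x)
    (b : H') :
    ρ (((b : H' ⧸ H.subgroupOf H').out : H') : G) x = ρ (b : G) x := by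
  obtain ⟨h, hh⟩ := QuotientGroup.mk_out_eq_mul (H.subgroupOf H') b
  have hmem : ((h : H') : G) ∈ H := Subgroup.mem_subgroupOf.mp h.2
  rw [hh, Subgroup.coe_mul, map_mul_apply, hx ⟨_, hmem⟩]

/-- Any section of `G → G ⧸ H` computes the relative trace of an `H`-fixed element. [folklore] -/
theorem sum_section_eq_sum_out [Fintype (G ⧸ H)] {x : A} (hx : ∀ h : H, ρ (h : G) x = x)
    (s : G ⧸ H → G)
    (hs : ∀ c, (s c : G ⧸ H) = c) : ∑ c : G ⧸ H, ρ (s c) x = ∑ c : G ⧸ H, ρ c.out x := by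
  refine Finset.sum_congr rfl fun c _ => ?_
  conv_rhs => rw [← hs c]
  rw [map_out_mk_apply ρ H hx]

/-- **Transitivity of relative traces** (`Tr_{H_M… }`: `Σ_{G/H} = Σ_{G/H'} ∘ Σ_{H'/H}`): for
`H ≤ H'` and an `H`-fixed `x`,
`∑_{c ∈ G/H} ρ c̃ x = ∑_{d ∈ G/H'} ρ d̃ (∑_{e ∈ H'/H} ρ ẽ x)`. [folklore] -/
theorem sum_quotient_eq_sum_quotient_sum {H' : Subgroup G} [Fintype (G ⧸ H)] [Fintype (G ⧸ H')]
    [Fintype (H' ⧸ H.subgroupOf H')] (hle : H ≤ H') {x : A}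
    (hx : ∀ h : H, ρ (h : G) x = x) :
    ∑ c : G ⧸ H, ρ c.out x =
      ∑ d : G ⧸ H', ρ d.out (∑ e : H' ⧸ H.subgroupOf H', ρ ((e.out : H') : G) x) := by
  rw [← (Subgroup.quotientEquivProdOfLE hle).symm.sum_comp, Fintype.sum_prod_type]
  refine Finset.sum_congr rfl fun d _ => ?_
  rw [map_sum]
  refine Finset.sum_congr rfl fun e _ => ?_
  induction e using QuotientGroup.induction_on with
  | H b =>
    have hsymm : (Subgroup.quotientEquivProdOfLE hle).symm (d, (b : H' ⧸ H.subgroupOf H')) =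
        ((d.out * (b : G) : G) : G ⧸ H) := by
      rw [Subgroup.quotientEquivProdOfLE_symm_apply]
      rfl
    rw [hsymm, map_out_mk_apply ρ H hx, map_out_mk_subgroupOf_apply ρ H H' hx, map_mul_apply]

/-- **Relative inert step**: a relation `∑_{e ∈ H'/H} ρ ẽ P = a · P₁` (`P` `H`-fixed; CLTZ 2015
Lemma 2.9 / Gross 3.7 (1) read inside the top field) folds one level of the tower:
`∑_{c ∈ G/H} ρ c̃ P = a · ∑_{d ∈ G/H'} ρ d̃ P₁`. [cite: CoatesLiTianZhai2015, Lemma 2.9] -/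
theorem sum_quotient_eq_smul_of_rel {H' : Subgroup G} [Fintype (G ⧸ H)] [Fintype (G ⧸ H')]
    [Fintype (H' ⧸ H.subgroupOf H')] (hle : H ≤ H') {P P₁ : A} {a : ℤ}
    (hP : ∀ h : H, ρ (h : G) P = P)
    (hrel : ∑ e : H' ⧸ H.subgroupOf H', ρ ((e.out : H') : G) P = a • P₁) :
    ∑ c : G ⧸ H, ρ c.out P = a • ∑ d : G ⧸ H', ρ d.out P₁ := by
  rw [sum_quotient_eq_sum_quotient_sum ρ H hle hP, hrel, Finset.smul_sum]
  refine Finset.sum_congr rfl fun d _ => ?_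
  rw [map_zsmul]

/-- The total trace is the relative trace over the trivial subgroup. [folklore] -/
theorem sum_eq_sum_quotient_bot [Fintype G] [Fintype (G ⧸ (⊥ : Subgroup G))] (x : A) :
    ∑ g : G, ρ g x = ∑ c : G ⧸ (⊥ : Subgroup G), ρ c.out x := by
  rw [← (QuotientGroup.quotientBot (G := G)).symm.sum_comp]
  have hx : ∀ h : (⊥ : Subgroup G), ρ (h : G) x = x := fun h => by
    rw [show (h : G) = 1 from h.2, map_one]; rfl
  refine Finset.sum_congr rfl fun g _ => ?_
  exact (map_out_mk_apply ρ ⊥ hx g).symm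

/-- **Two-level fold (template for `M = q·q′`)**: tower `K ⊂ H₁ ⊂ H_q ⊂ H_{qq′}` in `G = Gal(H_{qq′}/K)`,
`G_q ≤ G₁`; `Tr_{H_{qq′}/H_q} y_{qq′} = a·y_q` and `Tr_{H_q/H₁} y_q = a′·y₁` give
`∑_{g ∈ G} ρ g y_{qq′} = (a·a′)·Tr_{H₁/K} y₁`; longer towers iterate `sum_quotient_eq_smul_of_rel`.
[cite: CoatesLiTianZhai2015, Lemma 2.9] -/
theorem sum_eq_mul_smul_of_two_steps {G₁ Gq : Subgroup G} [Fintype G] [Fintype Gq]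
    [Fintype (G ⧸ Gq)] [Fintype (G ⧸ G₁)] [Fintype (G₁ ⧸ Gq.subgroupOf G₁)] (hle : Gq ≤ G₁)
    {yTop yq y₁ : A}
    {a a' : ℤ} (hyq : ∀ h : Gq, ρ (h : G) yq = yq)
    (htop : ∑ h : Gq, ρ (h : G) yTop = a • yq)
    (hmid : ∑ e : G₁ ⧸ Gq.subgroupOf G₁, ρ ((e.out : G₁) : G) yq = a' • y₁) :
    ∑ g : G, ρ g yTop = (a * a') • ∑ d : G ⧸ G₁, ρ d.out y₁ := by
  rw [sum_eq_smul_sum_quotient_of_trace_eq_smul ρ Gq htop,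
    sum_quotient_eq_smul_of_rel ρ Gq hle hyq hmid, smul_smul]

/-- A product of odd integers is odd (the tower multiplier `m = ∏ a_q · ∏ (a_q − 2)`). [folklore] -/
theorem odd_prod {ι : Type*} (s : Finset ι) (a : ι → ℤ) (h : ∀ i ∈ s, Odd (a i)) :
    Odd (∏ i ∈ s, a i) := by
  induction s using Finset.induction_on with
  | empty => simp
  | insert i s hi ih =>
    rw [Finset.prod_insert hi]
    exact (h i (Finset.mem_insert_self i s)).mul (ih fun j hj => h j (Finset.mem_insert_of_mem hj))

/-- `a − 2` is odd iff `a` is odd (the split-prime multiplier). [folklore] -/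
theorem odd_sub_two_iff (a : ℤ) : Odd (a - 2) ↔ Odd a :=
  ⟨fun h => by simpa using h.add_even even_two, fun h => h.sub_even even_two⟩

end Tower

/-! ### The split steps (need `G` commutative: `Gal(H_M/K)` is abelian for ring class fields) -/

section TowerComm

variable {G : Type*} [CommGroup G] (ρ : G →* AddMonoid.End A) (H : Subgroup G)

/-- **Split step** (Darmon 2004 Prop. 3.10: `Tr_{H_{nℓ}/H_n} P_{nℓ} = (a_ℓ − σ_λ − σ_λ⁻¹) P_n` for
`ℓ = λλ̄` split): if `∑_{h ∈ H} ρ h P = a · P₁ − (ρ σ P₁ + ρ σ⁻¹ P₁)` with `P₁` fixed by `H`, then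
`∑_{g ∈ G} ρ g P = (a − 2) · ∑_{c ∈ G/H} ρ c̃ P₁`. [cite: Darmon2004, Prop. 3.10] -/
theorem sum_eq_sub_two_smul_sum_quotient_of_trace_eq [Fintype G] [Fintype H] [Fintype (G ⧸ H)]
    {P P₁ : A} {a : ℤ} (σ : G)
    (hP₁ : ∀ h : H, ρ (h : G) P₁ = P₁)
    (hrel : ∑ h : H, ρ (h : G) P = a • P₁ - (ρ σ P₁ + ρ σ⁻¹ P₁)) :
    ∑ g : G, ρ g P = (a - 2) • ∑ c : G ⧸ H, ρ c.out P₁ := by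
  rw [sum_eq_sum_quotient_sum_subgroup ρ H, hrel]
  simp only [map_sub, map_add, map_zsmul, Finset.sum_sub_distrib, Finset.sum_add_distrib]
  have h1 : ∑ c : G ⧸ H, ρ c.out (ρ σ P₁) = ∑ c : G ⧸ H, ρ c.out P₁ := by
    have e : ∀ c : G ⧸ H, ρ c.out (ρ σ P₁) = ρ σ (ρ c.out P₁) := fun c => by
      rw [← map_mul_apply, ← map_mul_apply, mul_comm]
    simp_rw [e, ← map_sum]
    exact smul_sum_quotient_eq ρ H P₁ hP₁ σ
  have h2 : ∑ c : G ⧸ H, ρ c.out (ρ σ⁻¹ P₁) = ∑ c : G ⧸ H, ρ c.out P₁ := by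
    have e : ∀ c : G ⧸ H, ρ c.out (ρ σ⁻¹ P₁) = ρ σ⁻¹ (ρ c.out P₁) := fun c => by
      rw [← map_mul_apply, ← map_mul_apply, mul_comm]
    simp_rw [e, ← map_sum]
    exact smul_sum_quotient_eq ρ H P₁ hP₁ σ⁻¹
  rw [h1, h2, ← Finset.smul_sum, sub_smul, two_zsmul]

/-- **Relative split step**: a relation `∑_{e ∈ H'/H} ρ ẽ P = a · P₁ − (ρ σ P₁ + ρ σ⁻¹ P₁)` (`P`
`H`-fixed, `P₁` `H'`-fixed; Darmon 2004 Prop. 3.10 read inside the top field) folds one level: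
`∑_{c ∈ G/H} ρ c̃ P = (a − 2) · ∑_{d ∈ G/H'} ρ d̃ P₁`. [cite: Darmon2004, Prop. 3.10] -/
theorem sum_quotient_eq_sub_two_smul_of_rel {H' : Subgroup G} [Fintype (G ⧸ H)] [Fintype (G ⧸ H')]
    [Fintype (H' ⧸ H.subgroupOf H')] (hle : H ≤ H') {P P₁ : A} {a : ℤ}
    (σ : G) (hP : ∀ h : H, ρ (h : G) P = P) (hP₁ : ∀ h : H', ρ (h : G) P₁ = P₁)
    (hrel : ∑ e : H' ⧸ H.subgroupOf H', ρ ((e.out : H') : G) P = a • P₁ - (ρ σ P₁ + ρ σ⁻¹ P₁)) :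
    ∑ c : G ⧸ H, ρ c.out P = (a - 2) • ∑ d : G ⧸ H', ρ d.out P₁ := by
  rw [sum_quotient_eq_sum_quotient_sum ρ H hle hP, hrel]
  simp only [map_sub, map_add, map_zsmul, Finset.sum_sub_distrib, Finset.sum_add_distrib]
  have h1 : ∑ c : G ⧸ H', ρ c.out (ρ σ P₁) = ∑ c : G ⧸ H', ρ c.out P₁ := by
    have e : ∀ c : G ⧸ H', ρ c.out (ρ σ P₁) = ρ σ (ρ c.out P₁) := fun c => by
      rw [← map_mul_apply, ← map_mul_apply, mul_comm]
    simp_rw [e, ← map_sum]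
    exact smul_sum_quotient_eq ρ H' P₁ hP₁ σ
  have h2 : ∑ c : G ⧸ H', ρ c.out (ρ σ⁻¹ P₁) = ∑ c : G ⧸ H', ρ c.out P₁ := by
    have e : ∀ c : G ⧸ H', ρ c.out (ρ σ⁻¹ P₁) = ρ σ⁻¹ (ρ c.out P₁) := fun c => by
      rw [← map_mul_apply, ← map_mul_apply, mul_comm]
    simp_rw [e, ← map_sum]
    exact smul_sum_quotient_eq ρ H' P₁ hP₁ σ⁻¹
  rw [h1, h2, ← Finset.smul_sum, sub_smul, two_zsmul]

end TowerComm


end Summit.BirchSwinnertonDyer.Uniform.U2.GenusCongruence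

end
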